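import Summits.KontsevichZagierPeriods.KontsevichZagierPeriods.Theorems.RootDecompQuadraticDescentPair18HomotopyP15

/-! # `RootDecompQuadraticDescentPair18HomotopyP16` — part 16/31 of the mechanical ≤400-line split of `Pair18Homotopy_v14_noguard.lean` (sha256 72e9c8442b4af820…)
Source: decomp-kz lens-6 g9 `Pair18Homotopy.lean` v14 (HOME/decomp-kz-lens-6/g9/, sha256 3dda3232…; critic g4-48/g4-53/g4-56/g5 CLEARED; census pair #18 of crux stmt-KontsevichZagierPeriods-28994: homotopy cells, duplications, inversions, Euler–Landen, arc/angle regions; terminal `pair18_g8strips_of_grid : hEuler → hGrid → hAng4 → (g8 form of #18)`); `#guard_msgs … #print axioms` pins removed for landing.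
Split by census-1 g9 `gen/splitlean.py`: scopes re-opened with their `open`/`variable`/`set_option` context; mathematics and declaration order unchanged. -/

set_option linter.unusedSimpArgs false
noncomputable section
open _root_.Set MvPolynomial
namespace Summit.KontsevichZagierPeriods.RootDecompQuadraticDescent.Pair18Homotopy
open Literature.NumberTheory.Transcendental
open Literature.NumberTheory.Transcendental.KZ (RFun cube)
open Summit.KontsevichZagierPeriods.RootDecompQuadraticDescent.DarkPairs (rel_reflect_rep rel_double)
/-- Auxiliary step `vec2_1` (§2b): vec2 1. [bookkeeping] -/
private theorem vec2_1 (a b : ℝ) : (![a, b] : Fin 2 → ℝ) 1 = b := rfl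

/-- Auxiliary step `vec2_0` (§2b): vec2 0. [bookkeeping] -/
private theorem vec2_0 (a b : ℝ) : (![a, b] : Fin 2 → ℝ) 0 = a := rfl

/-- Auxiliary step `cube2` (§0): cube2. [bookkeeping] -/
private theorem cube2 {x : Fin 2 → ℝ} (hx : x ∈ KZ.cube 2) : (0 ≤ x 0 ∧ x 0 ≤ 1) ∧ (0 ≤ x 1 ∧ x 1 ≤ 1) := ⟨hx 0, hx 1⟩

section Arc2
open Literature.ModelTheory.ExponentialFields (IsSemialgebraic isSemialgebraic_setOf_eval_le
  isSemialgebraic_setOf_eval_pos)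

/-- the shear `(c,t) ↦ ((1+8t)c, t)`: `[CL3c | c(1+8t) ≤ 1] ≡ [N7]`. -/
theorem CL3A_cov : KZ.of CL3A - KZ.of N7.rep ∈ KZ.relations := by
  let Φ : (Fin 2 → ℝ) → (Fin 2 → ℝ) := fun z => ![(1 + 8 * z 1) * z 0, z 1]
  let Mz : (Fin 2 → ℝ) → Matrix (Fin 2) (Fin 2) ℝ := fun z => !![1 + 8 * z 1, 8 * z 0; 0, 1]
  let Φ' : (Fin 2 → ℝ) → (Fin 2 → ℝ) →L[ℝ] (Fin 2 → ℝ) := fun z =>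
    LinearMap.toContinuousLinearMap (Matrix.toLin' (Mz z))
  have hΦ'ap : ∀ z w, Φ' z w = ![(1 + 8 * z 1) * w 0 + 8 * z 0 * w 1, w 1] := by
    intro z w; funext i
    fin_cases i <;> simp [Φ', Mz, Matrix.toLin'_apply, Matrix.mulVec, dotProduct, Fin.sum_univ_two]
  have hdet : ∀ z, (Φ' z).det = 1 + 8 * z 1 := by
    intro z
    unfold ContinuousLinearMap.det
    simp [Φ', LinearMap.det_toLin', Mz, Matrix.det_fin_two]
  have hdom : N7.rep.domain = Φ '' CL3A.domain := by
    simp only [CL3A, KZ.IntegralRep.domain_restrict, RFun.rep_domain, PA]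
    ext w
    constructor
    · intro hw
      have hw0 := (hw 0).1
      have hw0' := (hw 0).2
      have hw1 := (hw 1).1
      have hp : (0:ℝ) < 1 + 8 * w 1 := by linarith
      refine ⟨![w 0 / (1 + 8 * w 1), w 1], ⟨?_, ?_⟩, ?_⟩
      · intro i
        fin_cases i
        · refine ⟨by simpa using div_nonneg hw0 hp.le, ?_⟩
          have : w 0 / (1 + 8 * w 1) ≤ 1 := by rw [div_le_one hp]; linarith
          simpa using this
        · simpa using hw 1
      · simp only [mem_setOf_eq, vec2_0, vec2_1, Matrix.cons_val_zero, Matrix.cons_val_one, Matrix.head_cons]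
        have : w 0 / (1 + 8 * w 1) * (1 + 8 * w 1) = w 0 := by field_simp
        linarith
      · funext i
        fin_cases i
        · have key : (1 + 8 * w 1) * (w 0 / (1 + 8 * w 1)) = w 0 := by field_simp
          simpa [Φ] using key
        · simp [Φ]
    · rintro ⟨z, ⟨hz, hle⟩, rfl⟩
      simp only [mem_setOf_eq] at hle
      have hz0 := (hz 0).1
      have hz1 := (hz 1).1
      intro i
      fin_cases i
      · exact ⟨by simp [Φ]; positivity, by simp [Φ]; linarith⟩
      · simpa [Φ] using hz 1
  refine KZ.changeOfVariablesRel_subset_relations ⟨2, CL3A, N7.rep, Φ, Φ', ?_, ?_, ?_, hdom, ?_, rfl⟩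
  · have hsd : IsSemialgebraic ℚ CL3A.domain := CL3A.isSemialgebraic_domain
    refine (isSemialgebraicMapOn_iff_forall_holds hsd).mpr fun i => ?_
    fin_cases i
    · exact (isSemialgebraicFunOn_aeval hsd ((C 1 + C 8 * X 1) * X 0)).congr fun z _ => by simp [Φ, map_add, map_sub, map_mul, map_pow, map_neg, aeval_C, aeval_X, map_one, map_ofNat, eq_ratCast, Rat.cast_one, Rat.cast_ofNat, Rat.cast_div, Rat.cast_neg, vec2_0, vec2_1, Matrix.cons_val_zero, Matrix.cons_val_one, Matrix.head_cons]
    · exact (isSemialgebraicFunOn_aeval hsd (X 1)).congr fun z _ => by simp [Φ]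
  · intro z hz
    have h0 : HasFDerivAt (fun w : Fin 2 → ℝ => (1 + 8 * w 1) * w 0)
        ((1 + 8 * z 1) • ContinuousLinearMap.proj (R := ℝ) (φ := fun _ : Fin 2 => ℝ) 0 +
          z 0 • ((8:ℝ) • ContinuousLinearMap.proj (R := ℝ) (φ := fun _ : Fin 2 => ℝ) 1)) z :=
      (((hasFDerivAt_apply (𝕜 := ℝ) 1 z).const_mul (8:ℝ)).const_add 1).mul (hasFDerivAt_apply (𝕜 := ℝ) 0 z)
    have h1 : HasFDerivAt (fun w : Fin 2 → ℝ => w 1)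
        (ContinuousLinearMap.proj (R := ℝ) (φ := fun _ : Fin 2 => ℝ) 1) z := hasFDerivAt_apply 1 z
    have hpi : HasFDerivAt Φ (Φ' z) z := by
      rw [hasFDerivAt_pi']
      intro i
      fin_cases i
      · have e : (ContinuousLinearMap.proj (R := ℝ) (φ := fun _ : Fin 2 => ℝ) 0).comp (Φ' z) =
            (1 + 8 * z 1) • ContinuousLinearMap.proj (R := ℝ) (φ := fun _ : Fin 2 => ℝ) 0 +
              z 0 • ((8:ℝ) • ContinuousLinearMap.proj (R := ℝ) (φ := fun _ : Fin 2 => ℝ) 1) := by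
          ext w; simp [hΦ'ap]; try ring
        simpa [e, Φ, Function.comp_def] using h0
      · have e : (ContinuousLinearMap.proj (R := ℝ) (φ := fun _ : Fin 2 => ℝ) 1).comp (Φ' z) =
            ContinuousLinearMap.proj (R := ℝ) (φ := fun _ : Fin 2 => ℝ) 1 := by
          ext w; simp [hΦ'ap]
        simpa [e, Φ] using h1
    exact hpi.hasFDerivWithinAt
  · intro z₁ hz₁ z₂ hz₂ heq
    have hz₁' : z₁ ∈ cube 2 := by
      have := hz₁; simp only [CL3A, KZ.IntegralRep.domain_restrict, PA] at this; exact this.1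
    have hp : (0:ℝ) < 1 + 8 * z₁ 1 := by linarith [(hz₁' 1).1]
    have e1 : z₁ 1 = z₂ 1 := by simpa [Φ] using congrFun heq 1
    have e0 : (1 + 8 * z₁ 1) * z₁ 0 = (1 + 8 * z₂ 1) * z₂ 0 := by simpa [Φ] using congrFun heq 0
    rw [← e1] at e0
    have e0' : z₁ 0 = z₂ 0 := mul_left_cancel₀ hp.ne' e0
    funext i
    fin_cases i
    · exact e0'
    · exact e1
  · intro z hz
    have hz' : z ∈ cube 2 ∧ z 0 * (1 + 8 * z 1) ≤ 1 := by
      simpa [CL3A, KZ.IntegralRep.domain_restrict, PA] using hz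
    obtain ⟨h0, h1⟩ := cube2 hz'.1
    have hp : (0:ℝ) < 1 + 8 * z 1 := by linarith
    have ha : (0 : ℝ) < 1 + 7 * z 1 := by linarith
    have hb : (0 : ℝ) < 1 + 7 * (1 + 8 * z 1) * z 0 := by nlinarith [mul_nonneg h1.1 h0.1]
    have hb' : (0 : ℝ) < 1 + 7 * ((1 + 8 * z 1) * z 0) := by nlinarith [hb]
    rw [hdet z, abs_of_pos hp]
    simp only [CL3A, KZ.IntegralRep.integrand_restrict, RFun.rep_integrand]
    simp only [CL3c, N7, CL3cDen, N7Den, RFun.fn, Φ, map_add, map_sub, map_mul, map_pow, map_neg, aeval_C, aeval_X, map_one, map_ofNat, eq_ratCast, Rat.cast_one, Rat.cast_ofNat, Rat.cast_div, Rat.cast_neg, vec2_0, vec2_1, Matrix.cons_val_zero, Matrix.cons_val_one, Matrix.head_cons]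
    field_simp

/-- the shear `(c,t) ↦ (((1+8t)c − 1)/8, t)`: `[CL3c | c(1+8t) ≥ 1] ≡ [N7 | w ≤ t]`. -/
theorem CL3B_cov : KZ.of CL3B - KZ.of N7U ∈ KZ.relations := by
  let Φ : (Fin 2 → ℝ) → (Fin 2 → ℝ) := fun z => ![(1 + 8 * z 1) * z 0 * (1 / 8) - 1 / 8, z 1]
  let Mz : (Fin 2 → ℝ) → Matrix (Fin 2) (Fin 2) ℝ := fun z => !![(1 + 8 * z 1) / 8, z 0; 0, 1]
  let Φ' : (Fin 2 → ℝ) → (Fin 2 → ℝ) →L[ℝ] (Fin 2 → ℝ) := fun z =>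
    LinearMap.toContinuousLinearMap (Matrix.toLin' (Mz z))
  have hΦ'ap : ∀ z w, Φ' z w = ![(1 + 8 * z 1) / 8 * w 0 + z 0 * w 1, w 1] := by
    intro z w; funext i
    fin_cases i <;> simp [Φ', Mz, Matrix.toLin'_apply, Matrix.mulVec, dotProduct, Fin.sum_univ_two]
  have hdet : ∀ z, (Φ' z).det = (1 + 8 * z 1) / 8 := by
    intro z
    unfold ContinuousLinearMap.det
    simp [Φ', LinearMap.det_toLin', Mz, Matrix.det_fin_two]
  have hdom : N7U.domain = Φ '' CL3B.domain := by
    simp only [N7U, CL3B, KZ.IntegralRep.domain_restrict, RFun.rep_domain, PB, TriU]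
    ext w
    constructor
    · rintro ⟨hw, hle⟩
      simp only [mem_setOf_eq] at hle
      have hw0 := (hw 0).1
      have hw1 := (hw 1).1
      have hw1' := (hw 1).2
      have hp : (0:ℝ) < 1 + 8 * w 1 := by linarith
      refine ⟨![(8 * w 0 + 1) / (1 + 8 * w 1), w 1], ⟨?_, ?_⟩, ?_⟩
      · intro i
        fin_cases i
        · refine ⟨by simp; positivity, ?_⟩
          have : (8 * w 0 + 1) / (1 + 8 * w 1) ≤ 1 := by rw [div_le_one hp]; linarith
          simpa using this
        · simpa using hw 1
      · simp only [mem_setOf_eq, vec2_0, vec2_1, Matrix.cons_val_zero, Matrix.cons_val_one, Matrix.head_cons]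
        have : (8 * w 0 + 1) / (1 + 8 * w 1) * (1 + 8 * w 1) = 8 * w 0 + 1 := by field_simp
        linarith
      · funext i
        fin_cases i
        · have key : (1 + 8 * w 1) * ((8 * w 0 + 1) / (1 + 8 * w 1)) * (1 / 8) - 1 / 8 = w 0 := by
            field_simp
            ring
          simpa [Φ] using key
        · simp [Φ]
    · rintro ⟨z, ⟨hz, hle⟩, rfl⟩
      simp only [mem_setOf_eq] at hle
      have hz0 := (hz 0).1
      have hz0' := (hz 0).2
      have hz1 := (hz 1).1
      have hz1' := (hz 1).2
      refine ⟨fun i => ?_, ?_⟩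
      · fin_cases i
        · refine ⟨by simp [Φ]; linarith, ?_⟩
          simp [Φ]
          nlinarith [mul_le_mul_of_nonneg_left hz0' (by linarith : (0:ℝ) ≤ 1 + 8 * z 1)]
        · simpa [Φ] using hz 1
      · simp only [mem_setOf_eq, Φ, vec2_0, vec2_1, Matrix.cons_val_zero, Matrix.cons_val_one, Matrix.head_cons]
        nlinarith [mul_le_mul_of_nonneg_left hz0' (by linarith : (0:ℝ) ≤ 1 + 8 * z 1)]
  refine KZ.changeOfVariablesRel_subset_relations ⟨2, CL3B, N7U, Φ, Φ', ?_, ?_, ?_, hdom, ?_, rfl⟩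
  · have hsd : IsSemialgebraic ℚ CL3B.domain := CL3B.isSemialgebraic_domain
    refine (isSemialgebraicMapOn_iff_forall_holds hsd).mpr fun i => ?_
    fin_cases i
    · exact (isSemialgebraicFunOn_aeval hsd ((C 1 + C 8 * X 1) * X 0 * C (1 / 8) - C (1 / 8))).congr
        fun z _ => by simp [Φ, map_add, map_sub, map_mul, map_pow, map_neg, aeval_C, aeval_X, map_one, map_ofNat, eq_ratCast, Rat.cast_one, Rat.cast_ofNat, Rat.cast_div, Rat.cast_neg, vec2_0, vec2_1, Matrix.cons_val_zero, Matrix.cons_val_one, Matrix.head_cons]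
    · exact (isSemialgebraicFunOn_aeval hsd (X 1)).congr fun z _ => by simp [Φ]
  · intro z hz
    have h0 : HasFDerivAt (fun w : Fin 2 → ℝ => (1 + 8 * w 1) * w 0 * (1 / 8) - 1 / 8)
        ((1 / 8 : ℝ) • ((1 + 8 * z 1) • ContinuousLinearMap.proj (R := ℝ) (φ := fun _ : Fin 2 => ℝ) 0 +
          z 0 • ((8:ℝ) • ContinuousLinearMap.proj (R := ℝ) (φ := fun _ : Fin 2 => ℝ) 1))) z :=
      (((((hasFDerivAt_apply (𝕜 := ℝ) 1 z).const_mul (8:ℝ)).const_add 1).mul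
        (hasFDerivAt_apply (𝕜 := ℝ) 0 z)).mul_const (1 / 8 : ℝ)).sub_const (1 / 8 : ℝ)
    have h1 : HasFDerivAt (fun w : Fin 2 → ℝ => w 1)
        (ContinuousLinearMap.proj (R := ℝ) (φ := fun _ : Fin 2 => ℝ) 1) z := hasFDerivAt_apply 1 z
    have hpi : HasFDerivAt Φ (Φ' z) z := by
      rw [hasFDerivAt_pi']
      intro i
      fin_cases i
      · have e : (ContinuousLinearMap.proj (R := ℝ) (φ := fun _ : Fin 2 => ℝ) 0).comp (Φ' z) =
            (1 / 8 : ℝ) • ((1 + 8 * z 1) • ContinuousLinearMap.proj (R := ℝ) (φ := fun _ : Fin 2 => ℝ) 0 +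
              z 0 • ((8:ℝ) • ContinuousLinearMap.proj (R := ℝ) (φ := fun _ : Fin 2 => ℝ) 1)) := by
          ext w; simp [hΦ'ap]; try ring
        simpa [e, Φ, Function.comp_def] using h0
      · have e : (ContinuousLinearMap.proj (R := ℝ) (φ := fun _ : Fin 2 => ℝ) 1).comp (Φ' z) =
            ContinuousLinearMap.proj (R := ℝ) (φ := fun _ : Fin 2 => ℝ) 1 := by
          ext w; simp [hΦ'ap]
        simpa [e, Φ] using h1
    exact hpi.hasFDerivWithinAt
  · intro z₁ hz₁ z₂ hz₂ heq
    have hz₁' : z₁ ∈ cube 2 := by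
      have := hz₁; simp only [CL3B, KZ.IntegralRep.domain_restrict, PB] at this; exact this.1
    have hp : (0:ℝ) < 1 + 8 * z₁ 1 := by linarith [(hz₁' 1).1]
    have e1 : z₁ 1 = z₂ 1 := by simpa [Φ] using congrFun heq 1
    have e0 : (1 + 8 * z₁ 1) * z₁ 0 * (1 / 8) - 1 / 8 = (1 + 8 * z₂ 1) * z₂ 0 * (1 / 8) - 1 / 8 := by
      simpa [Φ] using congrFun heq 0
    rw [← e1] at e0
    have e0' : z₁ 0 = z₂ 0 := by
      have : (1 + 8 * z₁ 1) * z₁ 0 = (1 + 8 * z₁ 1) * z₂ 0 := by linarith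
      exact mul_left_cancel₀ hp.ne' this
    funext i
    fin_cases i
    · exact e0'
    · exact e1
  · intro z hz
    have hz' : z ∈ cube 2 ∧ 1 ≤ z 0 * (1 + 8 * z 1) := by
      simpa [CL3B, KZ.IntegralRep.domain_restrict, PB] using hz
    obtain ⟨h0, h1⟩ := cube2 hz'.1
    have hp : (0:ℝ) < 1 + 8 * z 1 := by linarith
    have hp' : (0:ℝ) < (1 + 8 * z 1) / 8 := by positivity
    have ha : (0 : ℝ) < 1 + 7 * z 1 := by linarith
    have hb : (0 : ℝ) < 1 + 7 * (1 + 8 * z 1) * z 0 := by nlinarith [mul_nonneg h1.1 h0.1]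
    rw [hdet z, abs_of_pos hp']
    simp only [CL3B, N7U, KZ.IntegralRep.integrand_restrict, RFun.rep_integrand]
    simp only [CL3c, N7, CL3cDen, N7Den, RFun.fn, Φ, map_add, map_sub, map_mul, map_pow, map_neg, aeval_C, aeval_X, map_one, map_ofNat, eq_ratCast, Rat.cast_one, Rat.cast_ofNat, Rat.cast_div, Rat.cast_neg, vec2_0, vec2_1, Matrix.cons_val_zero, Matrix.cons_val_one, Matrix.head_cons]
    have e : (1:ℝ) + 7 * ((1 + 8 * z 1) * z 0 * (1 / 8) - 1 / 8) = (1 + 7 * (1 + 8 * z 1) * z 0) / 8 := by ring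
    rw [e]
    field_simp

/-- `[CL3] ≡ [N7] + [N7|w≤t]` (`¾log²8 = ½log²8 + ¼log²8`), exact. -/
theorem CL3_rel : KZ.of CL3.rep - KZ.of N7.rep - KZ.of N7U ∈ KZ.relations := by
  have e : KZ.of CL3.rep - KZ.of N7.rep - KZ.of N7U = (KZ.of CL3.rep - KZ.of CL3c.rep)
      + (KZ.of CL3c.rep - KZ.of CL3A - KZ.of CL3B) + (KZ.of CL3A - KZ.of N7.rep) + (KZ.of CL3B - KZ.of N7U) := by
    abel
  rw [e]
  exact add_mem (add_mem (add_mem CL3_sq add_CL3) CL3A_cov) CL3B_cov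

/-! ### `rel_split9`: two affine pieces of coordinate 1 at `t = 1/9`; `[B63] ≡ [Th7] + [A7]` -/

/-- Auxiliary definition `P9a`: P9a. [bookkeeping] -/
def P9a : Set (Fin 2 → ℝ) := cube 2 ∩ {z | 9 * z 1 ≤ 1}
/-- Auxiliary definition `P9b`: P9b. [bookkeeping] -/
def P9b : Set (Fin 2 → ℝ) := cube 2 ∩ {z | 1 ≤ 9 * z 1}
/-- Auxiliary step `isSemialgebraic_s9a`: is Semialgebraic s9a. [bookkeeping] -/
theorem isSemialgebraic_s9a : IsSemialgebraic ℚ {z : Fin 2 → ℝ | 9 * z 1 ≤ 1} := by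
  have h := isSemialgebraic_setOf_eval_le (R := ℝ) (C 9 * X 1 : MvPolynomial (Fin 2) ℚ) (C 1 : MvPolynomial (Fin 2) ℚ)
  have e : {x : Fin 2 → ℝ | aeval x (C 9 * X 1 : MvPolynomial (Fin 2) ℚ) ≤ aeval x (C 1 : MvPolynomial (Fin 2) ℚ)} =
      {z : Fin 2 → ℝ | 9 * z 1 ≤ 1} := by
    ext z
    have e1 : aeval z (C 9 * X 1 : MvPolynomial (Fin 2) ℚ) = 9 * z 1 := by
      simp only [map_mul, aeval_C, aeval_X, eq_ratCast, Rat.cast_ofNat]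
    have e2 : aeval z (C 1 : MvPolynomial (Fin 2) ℚ) = 1 := by
      simp only [aeval_C, eq_ratCast, Rat.cast_one]
    simp only [mem_setOf_eq, e1, e2]
  rw [e] at h; exact h
/-- Auxiliary step `isSemialgebraic_s9b`: is Semialgebraic s9b. [bookkeeping] -/
theorem isSemialgebraic_s9b : IsSemialgebraic ℚ {z : Fin 2 → ℝ | 1 ≤ 9 * z 1} := by
  have h := isSemialgebraic_setOf_eval_le (R := ℝ) (C 1 : MvPolynomial (Fin 2) ℚ) (C 9 * X 1 : MvPolynomial (Fin 2) ℚ)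
  have e : {x : Fin 2 → ℝ | aeval x (C 1 : MvPolynomial (Fin 2) ℚ) ≤ aeval x (C 9 * X 1 : MvPolynomial (Fin 2) ℚ)} =
      {z : Fin 2 → ℝ | 1 ≤ 9 * z 1} := by
    ext z
    have e1 : aeval z (C 9 * X 1 : MvPolynomial (Fin 2) ℚ) = 9 * z 1 := by
      simp only [map_mul, aeval_C, aeval_X, eq_ratCast, Rat.cast_ofNat]
    have e2 : aeval z (C 1 : MvPolynomial (Fin 2) ℚ) = 1 := by
      simp only [aeval_C, eq_ratCast, Rat.cast_one]
    simp only [mem_setOf_eq, e1, e2]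
  rw [e] at h; exact h
/-- Auxiliary step `isSemialgebraic_P9a`: is Semialgebraic P9a. [bookkeeping] -/
theorem isSemialgebraic_P9a : IsSemialgebraic ℚ P9a := KZ.isSemialgebraic_cube.inter isSemialgebraic_s9a
/-- Auxiliary step `isSemialgebraic_P9b`: is Semialgebraic P9b. [bookkeeping] -/
theorem isSemialgebraic_P9b : IsSemialgebraic ℚ P9b := KZ.isSemialgebraic_cube.inter isSemialgebraic_s9b
/-- Auxiliary step `volume_cut9`: volume cut9. [bookkeeping] -/
theorem volume_cut9 : MeasureTheory.volume {z : Fin 2 → ℝ | 9 * z 1 = 1} = 0 := by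
  have h := volume_setOf_aeval_eq_zero (k := ℚ) (m := 2) (C 9 * X 1 - C 1 : MvPolynomial (Fin 2) ℚ) (by
    intro h0
    have h1 := congr_arg (MvPolynomial.eval ![(0:ℝ), 0]) h0
    simp at h1)
  convert h using 2
  ext z
  simp [map_sub, map_mul, aeval_C, aeval_X, eq_ratCast, Rat.cast_ofNat, sub_eq_zero]

/-- Auxiliary step `P9a_image`: P9a image. [bookkeeping] -/
theorem P9a_image : P9a = (fun z : Fin 2 → ℝ => (![z 0, ((1 / 9 : ℚ) : ℝ) * z 1 + ((0 : ℚ) : ℝ)] : Fin 2 → ℝ)) '' cube 2 := by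
  ext w
  constructor
  · rintro ⟨hw, hle⟩
    simp only [mem_setOf_eq] at hle
    refine ⟨![w 0, 9 * w 1], ?_, ?_⟩
    · intro i
      fin_cases i
      · simpa using hw 0
      · exact ⟨by simpa using (by linarith [(hw 1).1] : (0:ℝ) ≤ 9 * w 1), by simpa using hle⟩
    · funext i
      fin_cases i
      · simp
      · simp
  · rintro ⟨z, hz, rfl⟩
    have hz1 := (hz 1).1
    have hz1' := (hz 1).2
    refine ⟨fun i => ?_, ?_⟩
    · fin_cases i
      · simpa using hz 0
      · exact ⟨by simp; positivity, by simp; linarith⟩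
    · simp only [mem_setOf_eq, vec2_1, Matrix.cons_val_one, Matrix.head_cons]
      push_cast
      linarith

end Arc2
end Summit.KontsevichZagierPeriods.RootDecompQuadraticDescent.Pair18Homotopy
end
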